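import Summits.QuantumFields.YangMills.Theorems.SmallCircleAnchorAbelianisingDeformation
import Literature.RepresentationTheory.CompactGroups.MaximalTorusCentralizerProofs

/-!
# Route `SmallCircleAnchor` of `YangMills`: the abelianising deformation exists unconditionally

Support file for the statement items of route `SmallCircleAnchor` whose first conjunct is the
existence of an ABELIANISING DEFORMATION (a continuous class function `V` on `G` minimised exactly
on one conjugacy class `Cl(g₀)` with `C_G(g₀)` abelian): `PolyakovAnchorClustering`
(stmt-QuantumFields-11144), `AnchorGap` (stmt-QuantumFields-11141) and `OneLayerAnchor`
(stmt-QuantumFields-11143). `SmallCircleAnchorAbelianisingDeformation.lean` settled that conjunct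
modulo the named Lie-theoretic facts `ExistsAbelianCentralizer` /
`compactLie_exists_abelian_centralizer` (Bröcker–tom Dieck IV (2.3)(i) with I (4.13)). Both facts
are now THEOREMS of the tree (`Literature.RepresentationTheory.CompactGroups.ExistsAbelianCentralizer_holds`,
`compactLie_exists_abelian_centralizer_holds`, file `MaximalTorusCentralizerProofs.lean`; an
independent second proof through Chevalley's algebraicity of compact linear groups and the
Zariski density of unitary points lives in `CompactMatrixGroupAlgebraic.lean`,
`UnitaryPointsZariskiDense.lean`, `MaximalConnectedAbelian.lean`, `ZariskiClosureUnitary.lean`),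
so the reductions become unconditional in the Lie theory:

* `exists_abelianisingDeformation_holds` — every compact simple `G` with a lattice representation
  carries an abelianising deformation;
* `polyakovAnchorClustering_of_clustering_holds`, `anchorGap_of_clustering_holds`,
  `oneLayerAnchor_of_clustering_holds` — each of the three items is implied by (indeed, given the
  deformation, amounts to) its ANALYTIC body alone: uniform-in-the-volume exponential clustering of
  the `E(β)V`-pinned finite-temperature Wilson theory for all large `β`, for every abelianising `V`
  (Polyakov's 1977 mechanism made rigorous — the open part; nothing here touches it).

What is NOT here: no progress on the analytic bodies (open problems; `AnchorGap` dominates the two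
support items, see `SmallCircleAnchorPolyakovAnchorClustering.lean` for the machine-checked
`AnchorGap → PolyakovAnchorClustering`).
-/

noncomputable section

namespace Summit.QuantumFields.YangMills.Theorems

open Summit.QuantumFields.YangMills.Theses.SmallCircleAnchor
open Literature.MathematicalPhysics.QuantumFieldTheory
open Literature.RepresentationTheory.CompactGroups

variable {G : Type} [Group G] [TopologicalSpace G] [IsTopologicalGroup G] [CompactSpace G]

/-- **Every compact simple `G` carries an abelianising deformation — unconditionally** (the
`V`-conjunct of `AnchorGap` / `OneLayerAnchor` / `PolyakovAnchorClustering`, route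
`SmallCircleAnchor`): `exists_abelianisingDeformation_of_existsAbelianCentralizer` fed with the
tree's theorem `ExistsAbelianCentralizer_holds` (Bröcker–tom Dieck IV (2.3)(i)). [folklore] -/
theorem exists_abelianisingDeformation_holds (hG : IsCompactSimpleLieGroup G) (r : LatticeRep G) :
    ∃ V : G → ℝ, (Continuous V ∧ (∀ a g : G, V (a * g * a⁻¹) = V g) ∧ ∃ g₀ : G,
      (∀ g : G, V g₀ ≤ V g) ∧ (∀ g : G, V g = V g₀ → ∃ a : G, g = a * g₀ * a⁻¹) ∧
      (∀ a b : G, a * g₀ = g₀ * a → b * g₀ = g₀ * b → a * b = b * a)) :=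
  exists_abelianisingDeformation_of_existsAbelianCentralizer ExistsAbelianCentralizer_holds hG r

/-- **`PolyakovAnchorClustering` reduced to its analytic body, unconditionally in the Lie
theory** (route `SmallCircleAnchor`, support item stmt-QuantumFields-11144): if for every compact
simple `G`, faithful unitary `r`, EVERY abelianising deformation `V` and every temporal extent
`T ≥ 1` the connected Polyakov-loop two-point function of the `E(β)V`-pinned finite-temperature
Wilson theory on `ℤ_T × (ℤ/L)³` decays exponentially in the spatial separation, uniformly in `L`,
for all `β ≥ β₀(T)` along some schedule `E ≥ ε₁` (the body of the item, verbatim), then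
`PolyakovAnchorClustering` holds: `polyakovAnchorClustering_of_clustering` with its Lie-theoretic
hypothesis discharged by `compactLie_exists_abelian_centralizer_holds`. [folklore] -/
theorem polyakovAnchorClustering_of_clustering_holds
    (hcl : ∀ (G : Type) [Group G] [TopologicalSpace G] [IsTopologicalGroup G] [CompactSpace G],
      IsCompactSimpleLieGroup G → letI : MeasurableSpace G := borel G;
      haveI : BorelSpace G := ⟨rfl⟩; ∀ (r : LatticeRep G) (V : G → ℝ),
      (Continuous V ∧ (∀ a g : G, V (a * g * a⁻¹) = V g) ∧ ∃ g₀ : G, (∀ g : G, V g₀ ≤ V g) ∧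
        (∀ g : G, V g = V g₀ → ∃ a : G, g = a * g₀ * a⁻¹) ∧
        (∀ a b : G, a * g₀ = g₀ * a → b * g₀ = g₀ * b → a * b = b * a)) →
      ∀ (T : ℕ) [NeZero T], ∀ ε₁ : ℝ, ∃ E : ℝ → ℝ, (∀ β : ℝ, ε₁ ≤ E β) ∧ ∃ β₀ : ℝ, ∀ β : ℝ, β₀ ≤ β → ∃ m : ℝ, 0 < m ∧ ∃ C : ℝ, ∀ (L : ℕ) [NeZero L], let St := ZMod T × (Fin 3 → ZMod L); let Cfg := St × Option (Fin 3) → G; let ν : MeasureTheory.Measure Cfg := MeasureTheory.Measure.pi fun _ => haarProbability G; let sh : St → Option (Fin 3) → St := fun x μ => Option.elim μ (x.1 + 1, x.2) fun i => (x.1, x.2 + Pi.single i 1); let pl : Cfg → St → Option (Fin 3) → Option (Fin 3) → G := fun U x μ κ => U (x, μ) * U (sh x μ, κ) * (U (sh x κ, μ))⁻¹ * (U (x, κ))⁻¹; let act : Cfg → ℝ := fun U => β * ∑ x : St, ∑ i : Fin 3, (r.ρ (pl U x none (some i))).trace.re + β * ∑ x : St, ∑ q : {q : Fin 3 × Fin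 3 // q.1 < q.2}, (r.ρ (pl U x (some q.1.1) (some q.1.2))).trace.re; let P : Cfg → (Fin 3 → ZMod L) → G := fun U x => (List.ofFn fun t : Fin T => U ((((t : ℕ) : ZMod T), x), none)).prod; let wgt : Cfg → ℝ := fun U => Real.exp (act U - E β * ∑ x : Fin 3 → ZMod L, V (P U x)); let Ex : (Cfg → ℝ) → ℝ := fun F => (∫ U, F U * wgt U ∂ν) / (∫ U, wgt U ∂ν); let χ := fun (U : Cfg) (x : Fin 3 → ZMod L) => (r.ρ (P U x)).trace; ∀ n : ℕ, 2 * n < L → let y : Fin 3 → ZMod L := Pi.single 0 (n : ZMod L); |Ex (fun U => (χ U 0 * (starRingEnd ℂ) (χ U y)).re) - (Ex (fun U => (χ U 0).re) * Ex (fun U => (χ U y).re) + Ex (fun U => (χ U 0).im) * Ex (fun U => (χ U y).im))| ≤ C * Real.exp (-(m * n))) :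
    PolyakovAnchorClustering :=
  polyakovAnchorClustering_of_clustering compactLie_exists_abelian_centralizer_holds hcl

/-- **`AnchorGap` reduced to its analytic body, unconditionally in the Lie theory** (route
`SmallCircleAnchor`, crux stmt-QuantumFields-11141): volume-uniform spatial exponential clustering
of bounded local observables of the `E(β)V`-pinned theory on `ℤ_T × (ℤ/L)³` for every abelianising
`V`, every `T ≥ 1` and all `β ≥ β₀(T)` (the body of the crux, verbatim) implies `AnchorGap`:
`anchorGap_of_clustering` with `compactLie_exists_abelian_centralizer_holds`. [folklore] -/
theorem anchorGap_of_clustering_holds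
    (hcl : ∀ (G : Type) [Group G] [TopologicalSpace G] [IsTopologicalGroup G] [CompactSpace G],
      IsCompactSimpleLieGroup G → letI : MeasurableSpace G := borel G;
      haveI : BorelSpace G := ⟨rfl⟩; ∀ (r : LatticeRep G) (V : G → ℝ),
      (Continuous V ∧ (∀ a g : G, V (a * g * a⁻¹) = V g) ∧ ∃ g₀ : G, (∀ g : G, V g₀ ≤ V g) ∧
        (∀ g : G, V g = V g₀ → ∃ a : G, g = a * g₀ * a⁻¹) ∧
        (∀ a b : G, a * g₀ = g₀ * a → b * g₀ = g₀ * b → a * b = b * a)) →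
      ∀ (T : ℕ) [NeZero T], ∀ ε₁ : ℝ, ∃ E : ℝ → ℝ, (∀ β : ℝ, ε₁ ≤ E β) ∧ ∃ β₀ : ℝ, ∀ β : ℝ, β₀ ≤ β → ∃ m : ℝ, 0 < m ∧ ∀ w : ℕ, ∃ C : ℝ, ∀ (L : ℕ) [NeZero L], let St := ZMod T × (Fin 3 → ZMod L); let Cfg := St × Option (Fin 3) → G; let ν : MeasureTheory.Measure Cfg := MeasureTheory.Measure.pi fun _ => haarProbability G; let sh : St → Option (Fin 3) → St := fun x μ => Option.elim μ (x.1 + 1, x.2) fun i => (x.1, x.2 + Pi.single i 1); let pl : Cfg → St → Option (Fin 3) → Option (Fin 3) → G := fun U x μ κ => U (x, μ) * U (sh x μ, κ) * (U (sh x κ, μ))⁻¹ * (U (x, κ))⁻¹; let act : Cfg → ℝ := fun U => β * ∑ x : St, ∑ i : Fin 3, (r.ρ (pl U x none (some i))).trace.re + β * ∑ x : St, ∑ q : {q : Fin 3 × Fin 3 // q.1 < q.2}, (r.ρ (pl U x (some q.1.1) (some q.1.2))).trace.re; let P : Cfg → (Fin 3 → ZMod L) → G := fun U x => (List.ofFn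 fun t : Fin T => U ((((t : ℕ) : ZMod T), x), none)).prod; let wgt : Cfg → ℝ := fun U => Real.exp (act U - E β * ∑ x : Fin 3 → ZMod L, V (P U x)); let Ex : (Cfg → ℝ) → ℝ := fun F => (∫ U, F U * wgt U ∂ν) / (∫ U, wgt U ∂ν); let σ : ℕ → Cfg → Cfg := fun n U p => U ((p.1.1, p.1.2 + Pi.single 0 (n : ZMod L)), p.2); ∀ (c : Fin 3 → ZMod L), let Loc := fun F : Cfg → ℝ => Measurable F ∧ (∀ U, |F U| ≤ 1) ∧ ∀ U U', (∀ p, (∀ i : Fin 3, (p.1.2 i - c i).val ≤ w) → U p = U' p) → F U = F U'; ∀ F₁ F₂ : Cfg → ℝ, Loc F₁ → Loc F₂ → ∀ n : ℕ, 2 * n < L → |Ex (fun U => F₁ U * F₂ (σ n U)) - Ex F₁ * Ex (fun U => F₂ (σ n U))| ≤ C * Real.exp (-(m * n))) :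
    AnchorGap :=
  anchorGap_of_clustering compactLie_exists_abelian_centralizer_holds hcl

/-- **`OneLayerAnchor` reduced to its analytic body, unconditionally in the Lie theory** (route
`SmallCircleAnchor`, support item stmt-QuantumFields-11143): uniform clustering of the one-layer
(`T = 1`) pinned model for every abelianising `V` and all `β ≥ β₀` (the body of the item,
verbatim) implies `OneLayerAnchor`: `oneLayerAnchor_of_clustering` with
`compactLie_exists_abelian_centralizer_holds`. [folklore] -/
theorem oneLayerAnchor_of_clustering_holds
    (hcl : ∀ (G : Type) [Group G] [TopologicalSpace G] [IsTopologicalGroup G] [CompactSpace G],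
      IsCompactSimpleLieGroup G → letI : MeasurableSpace G := borel G;
      haveI : BorelSpace G := ⟨rfl⟩; ∀ (r : LatticeRep G) (V : G → ℝ),
      (Continuous V ∧ (∀ a g : G, V (a * g * a⁻¹) = V g) ∧ ∃ g₀ : G, (∀ g : G, V g₀ ≤ V g) ∧
        (∀ g : G, V g = V g₀ → ∃ a : G, g = a * g₀ * a⁻¹) ∧
        (∀ a b : G, a * g₀ = g₀ * a → b * g₀ = g₀ * b → a * b = b * a)) →
      ∀ ε₁ : ℝ, ∃ E : ℝ → ℝ, (∀ β : ℝ, ε₁ ≤ E β) ∧ ∃ β₀ : ℝ, ∀ β : ℝ, β₀ ≤ β → ∃ m : ℝ, 0 < m ∧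
      ∀ w : ℕ, ∃ C : ℝ, ∀ (L : ℕ) [NeZero L],
      let St := ZMod 1 × (Fin 3 → ZMod L)
      let Cfg := St × Option (Fin 3) → G
      let ν : MeasureTheory.Measure Cfg := MeasureTheory.Measure.pi fun _ => haarProbability G
      let sh : St → Option (Fin 3) → St :=
        fun x μ => Option.elim μ (x.1 + 1, x.2) fun i => (x.1, x.2 + Pi.single i 1)
      let pl : Cfg → St → Option (Fin 3) → Option (Fin 3) → G :=
        fun U x μ κ => U (x, μ) * U (sh x μ, κ) * (U (sh x κ, μ))⁻¹ * (U (x, κ))⁻¹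
      let act : Cfg → ℝ := fun U =>
        β * ∑ x : St, ∑ i : Fin 3, (r.ρ (pl U x none (some i))).trace.re +
          β * ∑ x : St, ∑ q : {q : Fin 3 × Fin 3 // q.1 < q.2},
            (r.ρ (pl U x (some q.1.1) (some q.1.2))).trace.re
      let P : Cfg → (Fin 3 → ZMod L) → G :=
        fun U x => (List.ofFn fun t : Fin 1 => U ((((t : ℕ) : ZMod 1), x), none)).prod
      let wgt : Cfg → ℝ := fun U => Real.exp (act U - E β * ∑ x : Fin 3 → ZMod L, V (P U x))
      let Ex : (Cfg → ℝ) → ℝ := fun F => (∫ U, F U * wgt U ∂ν) / (∫ U, wgt U ∂ν)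
      let σ : ℕ → Cfg → Cfg := fun n U p => U ((p.1.1, p.1.2 + Pi.single 0 (n : ZMod L)), p.2)
      ∀ (c : Fin 3 → ZMod L),
      let Loc := fun F : Cfg → ℝ => Measurable F ∧ (∀ U, |F U| ≤ 1) ∧
        ∀ U U', (∀ p, (∀ i : Fin 3, (p.1.2 i - c i).val ≤ w) → U p = U' p) → F U = F U'
      ∀ F₁ F₂ : Cfg → ℝ, Loc F₁ → Loc F₂ → ∀ n : ℕ, 2 * n < L →
        |Ex (fun U => F₁ U * F₂ (σ n U)) - Ex F₁ * Ex (fun U => F₂ (σ n U))| ≤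
          C * Real.exp (-(m * n))) :
    OneLayerAnchor :=
  oneLayerAnchor_of_clustering compactLie_exists_abelian_centralizer_holds hcl

end Summit.QuantumFields.YangMills.Theorems

end
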